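import Summits.HodgeConjecture.HodgeConjecture.Theorems.PadicSemiregularLiftHodgeFermatVarietiesPQTwinCounting

/-!
# Level `pq` WITHOUT `p + 2 < q`, II — `G ≡ 0 ≢ H` is impossible; the unit-structure theorem `structure_units_pq'` under `5 ≤ p < q`, `11 ≤ q`

Part 2 of 5 (Sketch step 1, ll. 193–421): `false_of_G_zero` — if `G ≡ 0 ≢ H` then `o` is a non-zero constant on the fibre `{x : x ≡ a₀ (p)}`
(`q - 1 ≥ p + 1` units), so that fibre (or its negative) lies inside `s`; then `s` IS that fibre and `s.sum ≡ (q-1)a₀ (mod p)` forces `p ∣ q - 1`,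
absurd at `q = p + 2` and beyond — and **`structure_units_pq'`**: the structure of the unit entries of a Hodge `(p+1)`-tuple of level `pq` (the tree's
`PQ.structure_units_pq` with `p + 2 < q` replaced by `p < q`, `11 ≤ q`).

PROVENANCE. Cell hodge-nonav (HUMAN RULING D-0038), planner seat p1 g33: chapter ROUTE-P1AF addenda ADD2 ∕ ADD3 (memos `HOME/memos/ROUTE-P1AF-ADD2.md`
d3af0b1bf97b24f6, `…-ADD3.md` 5042c485c3dfa6c1; referee PASS 0∕0: ref g51 REF-P1AF-ADD2.md, REF-P1AF-ADD3.md 5111ed97ffe1fe84), frozen Sketch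
`HOME/p1/route/Sketch_P1AF_TWIN_ALL_g33.lean` (sha16 48c9088b216d60cb, 1063 lines, namespace `HodgeNonAV.P1AF.Twin`, farm rc 0 / 0 sorries / axioms
{propext, Classical.choice, Quot.sound}; re-elaborated 2026-08-28), split into five tree modules `…PQTwinCounting` → `…PQTwinStructure` → `…PQTwinFibre` →
`…PQTwinClassification` → `…PQTwinPayoff` by planner p1 g34 (landing kit HOME/p1/landing/); proof bodies verbatim; docstrings reworded per referee riders
N-ADD2-1 ∕ N-ADD3-1 (hypotheses read `5 ≤ p`, `p < q`, `11 ≤ q` as the theorems carry them; no cell tags; Aoki cites are METHOD attributions — the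
statements at the twin levels are not in print). A parallel `T`-family rather than a weakening of the tree's `PQFibre ∕ PQClassification ∕ PQPayoff`
hypothesis `p + 2 < q`, because Theorems files are append-only; an operator refactor may later merge the two spellings.
Extends line `cancel-by-any-claim-lattice` of crux `HodgeFermatVarieties` (route `PadicSemiregularLift`): land with `--supports stmt-HodgeConjecture-1334`
(or `--supports stmt-HodgeConjecture-19652 --as helper`). No instance, no new notation (Part 5's eight `local notation3` are the line's, verbatim from
`Theorems/PadicSemiregularLiftHodgeFermatVarietiesPQPayoff`), no sorry, no new axiom.
HONEST SCOPE: combinatorics of Hodge `(p+1)`-multisets of `ℤ/pq` and the HC pay-off for the Fermat `(p−1)`-folds `X^{p−1}_{pq}` MODULO the line's named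
facts (S0) and stub statements (S2↑, S2↓, S3a, S5) — exactly the hypotheses of the tree's `PQ.hodgeConjectureFor_pq`; Fermat varieties are dominated by
abelian motives, so this is inside the known (AV) region of the summit; NOTHING here proves the Hodge conjecture.
References (method): N. Aoki, Math. Ann. 266 (1983) Thm A′ (§7), Prop. 2.2 [cite: Aoki1983, Thm. A]; N. Aoki, J. Math. Soc. Japan 39 (1987) §1, Thm 2-1
[cite: Aoki1987, Thm. 2-1]; T. Shioda, Math. Ann. 245 (1979) [cite: Shioda1979PJA, Thm. I].
-/

set_option linter.dupNamespace false
set_option linter.unusedVariables false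

noncomputable section

namespace Summit.HodgeConjecture.HodgeConjecture.Theorems.CancelByAnyClaimLattice.PQTwin

open Finset
open Literature.AlgebraicGeometry.HodgeTheory Literature.AlgebraicGeometry.HodgeTheory.FermatCharacter
open Summit.HodgeConjecture.HodgeConjecture.Theorems.CancelByAnyClaimLattice.FiveQ
open Summit.HodgeConjecture.HodgeConjecture.Theorems.CancelByAnyClaimLattice.PQ
open Summit.HodgeConjecture.HodgeConjecture.Theorems.CancelByAnyClaimLattice

section LevelPQ

variable {p q : ℕ} [Fact p.Prime] [Fact q.Prime]

/-- **Case `G ≡ 0 ≢ H` is impossible** for `5 ≤ p < q`: `o` is a non-zero constant on the `q - 1 ≥ p + 1`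
units of the fibre `{x ≡ a₀ (p)}`, so that fibre or its negative lies in `s`, hence equals `s`, and then
`s.sum ≡ (q-1)·a₀ (mod p)` gives `p ∣ q - 1 = p + 1`. -/
theorem false_of_G_zero (hp : 5 ≤ p) (hpq : p < q) {s : Multiset (ZMod (p * q))} (hs : IsHodgeMultiset s)
    (h6 : Multiset.card s = p + 1)
    {G : (ZMod q)ˣ → ℂ} {H : (ZMod p)ˣ → ℂ}
    (ho : ∀ x : (ZMod (p * q))ˣ, (Multiset.count (x : ZMod (p * q)) s : ℂ) - Multiset.count (-(x : ZMod (p * q))) s =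
      G (ZMod.unitsMap (dvd_mul_left q p) x) + H (ZMod.unitsMap (dvd_mul_right p q) x))
    (hG0 : ∀ b, G b = 0) (hH0 : ∃ a, H a ≠ 0) : False := by
  classical
  have hpq' : p ≠ q := hpq.ne
  have hpq2 : p + 2 ≤ q := add_two_le_of_lt hp hpq
  -- the fibre over `a : (ℤ/p)ˣ`
  set F : (ZMod p)ˣ → Finset (ZMod (p * q))ˣ := fun a ↦ univ.filter fun x ↦ ZMod.unitsMap (dvd_mul_right p q) x = a
    with hF
  have hcardF : ∀ a, #(F a) = q - 1 := fun a ↦ card_fibre' hpq' a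
  -- KEY CLAIM: no fibre lies inside `s`
  have hclaim : ∀ a : (ZMod p)ˣ, (∀ x ∈ F a, 1 ≤ Multiset.count (x : ZMod (p * q)) s) → False := by
    intro a hFa
    set M : Multiset (ZMod (p * q)) := (F a).val.map (fun x : (ZMod (p * q))ˣ ↦ (x : ZMod (p * q))) with hM
    have hMle : M ≤ s := by
      rw [Multiset.le_iff_count]
      intro y
      by_cases hy : y ∈ M
      · obtain ⟨x, hx, rfl⟩ := Multiset.mem_map.mp hy
        rw [hM, Multiset.count_map_eq_count' _ _ Units.val_injective, Multiset.count_eq_one_of_mem (F a).nodup hx]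
        exact hFa x hx
      · rw [Multiset.count_eq_zero.mpr hy]; exact Nat.zero_le _
    have hMcard : Multiset.card M = q - 1 := by rw [hM, Multiset.card_map, Finset.card_val, hcardF]
    have hMs : M = s := Multiset.eq_of_le_of_card_le hMle (by rw [hMcard, h6]; omega)
    have hq2 : q - 1 = p + 1 := by
      have := Multiset.card_le_card hMle
      rw [hMcard, h6] at this
      omega
    -- reduce the sum mod `p`
    have hsum : s.sum = 0 := hs.1.2
    rw [← hMs, hM] at hsum
    have hf := congrArg (ZMod.castHom (dvd_mul_right p q) (ZMod p)) hsum
    rw [_root_.map_multiset_sum, Multiset.map_map, map_zero] at hf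
    have hconst : ((F a).val.map ((ZMod.castHom (dvd_mul_right p q) (ZMod p)) ∘ fun x : (ZMod (p * q))ˣ ↦ (x : ZMod (p * q)))) =
        (F a).val.map (fun _ ↦ ((a : (ZMod p)ˣ) : ZMod p)) := by
      refine Multiset.map_congr rfl fun x hx ↦ ?_
      have hx' : ZMod.unitsMap (dvd_mul_right p q) x = a := by
        have := (Finset.mem_filter.mp (show x ∈ F a from hx)).2
        exact this
      rw [Function.comp_apply, ← hx']
      simp [ZMod.unitsMap_def]
    rw [hconst, Multiset.map_const', Multiset.sum_replicate, Finset.card_val, hcardF, hq2, nsmul_eq_mul] at hf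
    -- `(p + 1) • a = a ≠ 0` in `ℤ/p`
    have hcast : ((p + 1 : ℕ) : ZMod p) = 1 := by
      rw [Nat.cast_add, ZMod.natCast_self, zero_add, Nat.cast_one]
    rw [hcast, one_mul] at hf
    exact (Units.ne_zero a) hf
  -- the value of `o` on the fibre of `a₀`
  obtain ⟨a₀, ha₀⟩ := hH0
  have hval : ∀ a (x : (ZMod (p * q))ˣ), x ∈ F a →
      (Multiset.count (x : ZMod (p * q)) s : ℂ) - Multiset.count (-(x : ZMod (p * q))) s = H a := by
    intro a x hx
    have hx' : ZMod.unitsMap (dvd_mul_right p q) x = a := (Finset.mem_filter.mp hx).2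
    rw [ho x, hG0, zero_add, hx']
  obtain ⟨x₀, hx₀, -⟩ := exists_unit_of_unitsMap hpq' a₀ (1 : (ZMod q)ˣ)
  have hx₀F : x₀ ∈ F a₀ := by simp [hF, hx₀]
  rcases lt_or_ge (Multiset.count (-(x₀ : ZMod (p * q))) s) (Multiset.count (x₀ : ZMod (p * q)) s) with hlt | hge
  · -- `o > 0` on the fibre of `a₀`: the fibre lies in `s`
    refine hclaim a₀ fun x hx ↦ ?_
    have h := hval a₀ x hx
    rw [← hval a₀ x₀ hx₀F] at h
    have h' : (Multiset.count (x : ZMod (p * q)) s : ℤ) - Multiset.count (-(x : ZMod (p * q))) s =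
        (Multiset.count (x₀ : ZMod (p * q)) s : ℤ) - Multiset.count (-(x₀ : ZMod (p * q))) s := by
      exact_mod_cast h
    omega
  · -- `o < 0` on the fibre of `a₀` (it is `H a₀ ≠ 0`): the fibre of `-a₀` lies in `s`
    have hne : Multiset.count (-(x₀ : ZMod (p * q))) s ≠ Multiset.count (x₀ : ZMod (p * q)) s := by
      intro heq
      apply ha₀
      rw [← hval a₀ x₀ hx₀F, heq, sub_self]
    refine hclaim (-a₀) fun x hx ↦ ?_
    -- `-x` lies in the fibre of `a₀`
    have hxF : -x ∈ F a₀ := by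
      have hx' : ZMod.unitsMap (dvd_mul_right p q) x = -a₀ := (Finset.mem_filter.mp hx).2
      simp [hF, unitsMap_neg, hx']
    have h := hval a₀ (-x) hxF
    rw [← hval a₀ x₀ hx₀F, Units.val_neg, neg_neg] at h
    have h' : (Multiset.count (-(x : ZMod (p * q))) s : ℤ) - Multiset.count (x : ZMod (p * q)) s =
        (Multiset.count (x₀ : ZMod (p * q)) s : ℤ) - Multiset.count (-(x₀ : ZMod (p * q))) s := by
      exact_mod_cast h
    omega

/-- **STRUCTURE OF THE UNIT ENTRIES OF A HODGE `(p+1)`-TUPLE OF LEVEL `pq`, twin-inclusive version**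
(`5 ≤ p < q`, `11 ≤ q`; covers `q = p + 2`): the conclusion of `PQ.structure_units_pq` verbatim.
(statement: line `cancel-by-any-claim-lattice` ∕ cell hodge-nonav P1 g33; method after Aoki 1983 §7, Thm A′) -/
theorem structure_units_pq' : ∀ {p q : ℕ} [Fact p.Prime] [Fact q.Prime], 5 ≤ p → p < q → 11 ≤ q →
    ∀ {s : Multiset (ZMod (p * q))}, IsHodgeMultiset s → Multiset.card s = p + 1 →
    (∀ x : (ZMod (p * q))ˣ, Multiset.count (x : ZMod (p * q)) s = Multiset.count (-(x : ZMod (p * q))) s) ∨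
    ∃ b₁ : (ZMod q)ˣ,
      (∀ x : (ZMod (p * q))ˣ, ZMod.unitsMap (dvd_mul_left q p) x = b₁ →
        Multiset.count (-(x : ZMod (p * q))) s + 1 ≤ Multiset.count (x : ZMod (p * q)) s) ∧
      (∀ x : (ZMod (p * q))ˣ, ZMod.unitsMap (dvd_mul_left q p) x ≠ b₁ → ZMod.unitsMap (dvd_mul_left q p) x ≠ -b₁ →
        Multiset.count (x : ZMod (p * q)) s = Multiset.count (-(x : ZMod (p * q))) s) := by
  intro p q _ _ hp hpq1 hq s hs h6
  classical
  have hpq : p ≠ q := hpq1.ne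
  obtain ⟨G, H, hG, hH, ho⟩ := units_oddPart_split_pq hpq hs
  have hA : Multiset.card (s.filter IsUnit) ≤ p + 1 := (Multiset.card_le_card (Multiset.filter_le _ _)).trans h6.le
  have hsupp_le := card_support_le ho
  -- Case 1: `H ≢ 0` is impossible (the two new lemmas)
  by_cases hH0 : ∃ a, H a ≠ 0
  · exfalso
    by_cases hG0 : ∃ b, G b ≠ 0
    · exact false_of_both_ne_zero hp hpq1 hq hA hG hH ho hG0 hH0
    · push Not at hG0
      exact false_of_G_zero hp hpq1 hs h6 ho hG0 hH0
  -- Case 2: `H ≡ 0` — verbatim from `PQ.structure_units_pq`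
  push Not at hH0
  have ho' : ∀ x : (ZMod (p * q))ˣ, (Multiset.count (x : ZMod (p * q)) s : ℂ) - Multiset.count (-(x : ZMod (p * q))) s =
      G (ZMod.unitsMap (dvd_mul_left q p) x) := fun x ↦ by rw [ho x, hH0, add_zero]
  by_cases hG0 : ∀ b, G b = 0
  · left
    intro x
    have h := ho' x
    rw [hG0, sub_eq_zero] at h
    exact_mod_cast h
  · right
    push Not at hG0
    set SG : Finset (ZMod q)ˣ := univ.filter fun b ↦ G b ≠ 0 with hSG
    have hSGneg : ∀ b, b ∈ SG ↔ -b ∈ SG := fun b ↦ by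
      simp only [hSG, mem_filter, mem_univ, true_and, hG b, neg_ne_zero]
    have hfix : ∀ b : (ZMod q)ˣ, b ≠ -b := units_ne_neg (by omega)
    have hsupp_eq : #(univ.filter fun x : (ZMod (p * q))ˣ ↦
        G (ZMod.unitsMap (dvd_mul_left q p) x) + H (ZMod.unitsMap (dvd_mul_right p q) x) ≠ 0) = (p - 1) * #SG := by
      rw [card_eq_sum_card_fibre]
      have hfib : ∀ b : (ZMod q)ˣ, #((univ.filter fun x : (ZMod (p * q))ˣ ↦
          G (ZMod.unitsMap (dvd_mul_left q p) x) + H (ZMod.unitsMap (dvd_mul_right p q) x) ≠ 0).filter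
            fun x ↦ ZMod.unitsMap (dvd_mul_left q p) x = b) = if G b ≠ 0 then p - 1 else 0 := by
        intro b
        by_cases hb : G b ≠ 0
        · rw [if_pos hb]
          have : ((univ.filter fun x : (ZMod (p * q))ˣ ↦
              G (ZMod.unitsMap (dvd_mul_left q p) x) + H (ZMod.unitsMap (dvd_mul_right p q) x) ≠ 0).filter
                fun x ↦ ZMod.unitsMap (dvd_mul_left q p) x = b) =
              univ.filter fun x : (ZMod (p * q))ˣ ↦ ZMod.unitsMap (dvd_mul_left q p) x = b := by
            ext x
            simp only [mem_filter, mem_univ, true_and, and_iff_right_iff_imp]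
            intro hx
            rw [hx, hH0, add_zero]; exact hb
          rw [this, card_fibre hpq b]
        · rw [if_neg hb]
          rw [Finset.card_eq_zero, Finset.filter_eq_empty_iff]
          intro x hx hxb
          simp only [mem_filter, mem_univ, true_and] at hx
          rw [hxb, hH0, add_zero] at hx
          exact hb hx
      rw [Finset.sum_congr rfl fun b _ ↦ hfib b, Finset.sum_ite, Finset.sum_const_zero, add_zero,
        Finset.sum_const, smul_eq_mul, mul_comm]
    have hSG3 : #SG ≤ 3 := by
      have h := hsupp_le
      rw [hsupp_eq] at h
      by_contra h4
      push Not at h4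
      have : (p - 1) * 4 ≤ (p - 1) * #SG := Nat.mul_le_mul_left _ h4
      omega
    obtain ⟨b₀, hb₀⟩ := hG0
    have hb₀S : b₀ ∈ SG := by simp [hSG, hb₀]
    have hSG2 : SG = {b₀, -b₀} := by
      have hsub : ({b₀, -b₀} : Finset (ZMod q)ˣ) ⊆ SG := by
        intro b hb
        simp only [mem_insert, mem_singleton] at hb
        rcases hb with rfl | rfl
        · exact hb₀S
        · exact (hSGneg b₀).mp hb₀S
      by_contra hne
      have hss : ({b₀, -b₀} : Finset (ZMod q)ˣ) ⊂ SG := lt_of_le_of_ne hsub (Ne.symm hne)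
      obtain ⟨b, hbS, hbnot⟩ := Finset.exists_of_ssubset hss
      have hbnot' : -b ∉ ({b₀, -b₀} : Finset (ZMod q)ˣ) := by
        simp only [mem_insert, mem_singleton, not_or] at hbnot ⊢
        exact ⟨fun h ↦ hbnot.2 (by rw [← h, neg_neg]), fun h ↦ hbnot.1 (neg_injective h)⟩
      have h4 : ({b₀, -b₀, b, -b} : Finset (ZMod q)ˣ) ⊆ SG := by
        intro x hx
        simp only [mem_insert, mem_singleton] at hx
        rcases hx with rfl | rfl | rfl | rfl
        · exact hb₀S
        · exact (hSGneg b₀).mp hb₀S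
        · exact hbS
        · exact (hSGneg b).mp hbS
      have hcard4 : #({b₀, -b₀, b, -b} : Finset (ZMod q)ˣ) = 4 := by
        simp only [mem_insert, mem_singleton, not_or] at hbnot hbnot'
        rw [card_insert_of_notMem, card_insert_of_notMem, card_pair (hfix b)]
        · simp only [mem_insert, mem_singleton, not_or]
          exact ⟨fun h ↦ hbnot.2 h.symm, fun h ↦ hbnot'.2 h.symm⟩
        · simp only [mem_insert, mem_singleton, not_or]
          exact ⟨hfix b₀, fun h ↦ hbnot.1 h.symm, fun h ↦ hbnot'.1 h.symm⟩
      have := card_le_card h4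
      omega
    have hval : ∀ x : (ZMod (p * q))ˣ, ZMod.unitsMap (dvd_mul_left q p) x = b₀ →
        (Multiset.count (x : ZMod (p * q)) s : ℂ) - Multiset.count (-(x : ZMod (p * q))) s = G b₀ :=
      fun x hx ↦ by rw [ho' x, hx]
    have hoff : ∀ x : (ZMod (p * q))ˣ, ZMod.unitsMap (dvd_mul_left q p) x ≠ b₀ →
        ZMod.unitsMap (dvd_mul_left q p) x ≠ -b₀ →
        Multiset.count (x : ZMod (p * q)) s = Multiset.count (-(x : ZMod (p * q))) s := by
      intro x h1 h2
      have hx : ZMod.unitsMap (dvd_mul_left q p) x ∉ SG := by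
        rw [hSG2]; simp [h1, h2]
      simp only [hSG, mem_filter, mem_univ, true_and, not_not] at hx
      have h := ho' x
      rw [hx, sub_eq_zero] at h
      exact_mod_cast h
    obtain ⟨x₀, -, hx₀⟩ := exists_unit_of_unitsMap hpq (1 : (ZMod p)ˣ) b₀
    rcases lt_or_ge (Multiset.count (-(x₀ : ZMod (p * q))) s) (Multiset.count (x₀ : ZMod (p * q)) s) with hlt | hge
    · refine ⟨b₀, fun x hx ↦ ?_, hoff⟩
      have h := hval x hx
      rw [← hval x₀ hx₀] at h
      have h' : (Multiset.count (x : ZMod (p * q)) s : ℤ) - Multiset.count (-(x : ZMod (p * q))) s =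
          (Multiset.count (x₀ : ZMod (p * q)) s : ℤ) - Multiset.count (-(x₀ : ZMod (p * q))) s := by
        exact_mod_cast h
      omega
    · have hne : Multiset.count (-(x₀ : ZMod (p * q))) s ≠ Multiset.count (x₀ : ZMod (p * q)) s := by
        intro heq
        apply hb₀
        rw [← hval x₀ hx₀, heq, sub_self]
      refine ⟨-b₀, fun x hx ↦ ?_, fun x h1 h2 ↦ hoff x (by rw [neg_neg] at h2; exact h2) h1⟩
      have hx' : ZMod.unitsMap (dvd_mul_left q p) (-x) = b₀ := by rw [unitsMap_neg, hx, neg_neg]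
      have h := hval (-x) hx'
      rw [← hval x₀ hx₀, Units.val_neg, neg_neg] at h
      have h' : (Multiset.count (-(x : ZMod (p * q))) s : ℤ) - Multiset.count (x : ZMod (p * q)) s =
          (Multiset.count (x₀ : ZMod (p * q)) s : ℤ) - Multiset.count (-(x₀ : ZMod (p * q))) s := by
        exact_mod_cast h
      omega

end LevelPQ

end Summit.HodgeConjecture.HodgeConjecture.Theorems.CancelByAnyClaimLattice.PQTwin

end
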